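/-
Copyright (c) 2026 the pub-hodgecm-mathlib formalisation cell (harness21).  Prover seat hodgecm-mathlib-K2E1-p16 (g2), Track B «K2-LIT» ENGINE E1, h413 = `stmt-HodgeConjecture-24833`,
route `HCCMUnconditional`, R90-S8 «ContSpec-n½» TWIN-DAG row 8 (dealer R90-CS-plan (g2), S8-R19 (F)) — THE M1 PRINT AT `N = 3`, the twin of ★ `K2E1ChiEisensteinMeromorphicExportsM1CMTwo` (K2E1-p14).
-/
import Summits.HodgeConjecture.HodgeConjecture.Theorems.K2E1ChiEisensteinMeromorphicExportsU3GlobalCM   -- ★ row 6 (this seat): `chiEisenstein_meromorphic_exports_cm_three_of_letters`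
import Summits.HodgeConjecture.HodgeConjecture.Theorems.K2E1ChiConvDataMaximalLevelCMThree             -- ★ row 7a (this seat, p862079): the M1 ball data `exists_convData_maximalLevel_cm_three` (letter bundle `hCD`)
import Summits.HodgeConjecture.HodgeConjecture.Theorems.K2E1ChiScatteringCoordsPairCMThree             -- ★ ED. 2 corollaries (this seat, p862274): `intertwinedCoeff_mem_chiSectionSpacePair`; brings ★ row 7c `exists_scatteringCoords_cm_three`, ★ `chiSectionSpacePair_one`
import HarnessLib

/-!
# h413 ∕ Track B «K2-LIT», R90-S8 TWIN-DAG row 8 — `K2E1ChiEisensteinMeromorphicExportsM1CMThree`: THE MEROMORPHIC CONTINUATION TO `ℂ` OF `E(f_z^φ)` AND OF ITS SCATTERING COORDINATES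
# FOR EVERY M1 FAMILY `φ ∈ V(χ, K, 1)`, `φ ∘ ι_∞ = φ(1)`, OF `U(2,1)_{L∕L⁺}` — LETTER-FREE except the M1 condition `hφinf` (χ_∞ = 1) itself

Cell `pub/hodgecm-mathlib`, crux H413 = `stmt-HodgeConjecture-24833`; dealer R90-CS-plan (g2) S8-R19 (F) «row 8 = K2E1-p16».  THEOREMS ONLY (no `def`, no `instance`, no `notation`,
no named-fact hypothesis, no `sorry`); lane `--kind proof --supports stmt-HodgeConjecture-24833 --as helper` (count-neutral).  The token-for-token `N = 3` twin of ★
`K2E1ChiEisensteinMeromorphicExportsM1CMTwo.chiEisenstein_meromorphic_exports_maximalLevel_cm_two` (K2E1-p14): `2 ↦ 3`, `{1 < Re} ↦ {2 < Re}`, `z − 1 ↦ z − 2`, `P ⊆ {Re ≤ 2}`; the M1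
family is the `χ₂ = 1` sub-family `V(χ, K, 1) = V(χ, 1; K, 1)` (★ `chiSectionSpacePair_one`) of the PAIR currency of ★ rows 4–6, entered through ★ `IsChiSection.isChiSectionPair_of_trivial`
and §1 `isAutomorphic_one`.

THE MATHEMATICS [BernsteinLapid2019, Thm 2.3, §4, §7; MoeglinWaldspurger1995, II.1.7, IV.1.8–IV.1.11].  ONE CALL of ★ row 6 `chiEisenstein_meromorphic_exports_cm_three_of_letters` (X2_χ (A) at
the CM pair, `N = 3`) with BOTH letter families PAID: `hCD` (per ball: the convolution data WITH the scalar-action clause) by ★ row 7a `exists_convData_maximalLevel_cm_three`, and `hq`∕`hqφ`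
(the scattering coordinates of `(ν𝓕)⁻¹·M(z)φ` in a basis `bV` of `V(χʷ, K, 1)`, holomorphic on `{2 < Re}`) by §1 `exists_scatteringCoords_of_basis_cm_three_one` (★ row 7c + ★ ED. 2
`intertwinedCoeff_mem_chiSectionSpacePair` at `χ₂ = 1`).  RESULT, for every Hecke character `χ` of `L`, every continuous bounded `φ ∈ V(χ, K, 1)` with `φ ∘ ι_∞ = φ(1)`, every basis `bV`
of `V(χʷ, K, 1)` by continuous bounded functions: scattering coordinates `q_j` holomorphic on `{2 < Re}` with `Σ_j q_j(z)·bV_j = (ν𝓕)⁻¹·φ̃_z·H^{z−2}`, and `Ec : ℂ → G(𝔸) → ℂ`, `qc_j : ℂ → ℂ`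
MEROMORPHIC IN NORMAL FORM ON `ℂ`, `Ec z = E(f_z^φ)`, `qc_j z = q_j z` on `{2 < Re}`, ONE closed discrete pole set `P ⊆ {Re ≤ 2}` off which all are analytic, `g ↦ Ec z g` continuous
off `P` — (E1)–(E4) for the M1 families of `U(2,1)`.
HONEST LABEL: HC_CM is proved only modulo the 7 printed citations (2 remaining named inputs: hLiu418 = `stmt-HodgeConjecture-24832`, h413 = `stmt-HodgeConjecture-24833`) until rung 0
closes; count-neutral helper, closes no socket; the ONLY hypothesis beyond the structural data is the M1 condition `hφinf` (and the basis `bV` with its regularity).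

## References
* [BernsteinLapid2019] J. Bernstein, E. Lapid, *On the meromorphic continuation of Eisenstein series*, J. Amer. Math. Soc. 37 (2024) (arXiv:1911.02342), Thm 2.3, §4, §7.
* [MoeglinWaldspurger1995] C. Mœglin, J.-L. Waldspurger, *Spectral Decomposition and Eisenstein Series* (1995), II.1.7, IV.1.8–IV.1.11.
-/

set_option autoImplicit false
-- the mandated namespace repeats `HodgeConjecture.HodgeConjecture`, as in every `Theorems/*.lean` of this sub-problem
set_option linter.dupNamespace false

noncomputable section

open MeasureTheory Measure Filter Topology Set NumberField IsDedekindDomain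
open scoped NNReal ENNReal
open Literature.MeasureTheory.Group Literature.NumberTheory Literature.NumberTheory.Automorphic Literature.NumberTheory.Automorphic.UnitaryGroup AdelicGroupData
open Literature.NumberTheory.Automorphic.Arthur2013.Leaves.TECR
open Literature.NumberTheory.GaloisRepresentations (HeckeCharacter)
open Summit.HodgeConjecture.HodgeConjecture.Cruxes.H413.K2E1BorelEisensteinU
open Summit.HodgeConjecture.HodgeConjecture.Cruxes.H413.K2E1BLBorelSpacesU2Defs
open Summit.HodgeConjecture.HodgeConjecture.Cruxes.H413.K2E1BLBorelOperatorsU2Defs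
open Summit.HodgeConjecture.HodgeConjecture.Cruxes.H413.K2E1CharacterEisensteinU2Defs
open Summit.HodgeConjecture.HodgeConjecture.Cruxes.H413.K2E1ChiSectionSpaceU2Defs
open Summit.HodgeConjecture.HodgeConjecture.Cruxes.H413.K2E1ChiEisensteinMeromorphicExportsU3GlobalCM (chiEisenstein_meromorphic_exports_cm_three_of_letters)
open Summit.HodgeConjecture.HodgeConjecture.Cruxes.H413.K2E1ChiConvDataMaximalLevelCMThree (exists_convData_maximalLevel_cm_three)
open Summit.HodgeConjecture.HodgeConjecture.Cruxes.H413.K2E1ChiScatteringCoordsHolomorphicCMThree (exists_scatteringCoords_cm_three)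
open Summit.HodgeConjecture.HodgeConjecture.Cruxes.H413.K2E1ChiScatteringCoordsPairCMThree (intertwinedCoeff_mem_chiSectionSpacePair)
open Summit.HodgeConjecture.HodgeConjecture.Cruxes.H413.K2E1CharacterEisensteinU3PairDefs (IsChiSectionPair IsChiSection.isChiSectionPair_of_trivial)
open Summit.HodgeConjecture.HodgeConjecture.Cruxes.H413.K2E1ChiSectionSpaceU3PairDefs (chiSectionSpacePair chiSectionSpacePair_one)

namespace Summit.HodgeConjecture.HodgeConjecture.Cruxes.H413.K2E1ChiEisensteinMeromorphicExportsM1CMThree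

variable (L : Type) [Field L] [NumberField L] [IsCMField L]
  [MeasurableSpace (quasiSplit (↥(maximalRealSubfield L)) L (IsCMField.complexConj L) 3).Adelic] [BorelSpace (quasiSplit (↥(maximalRealSubfield L)) L (IsCMField.complexConj L) 3).Adelic]

/-! ## §1 The `χ₂ = 1` read-backs: automorphy of the trivial torus character, and the scattering coordinates in a basis of `V(χʷ, K′, ω)` -/

section One

variable {F E : Type} [Field F] [Field E] [NumberField E] [Algebra F E]

/-- The trivial continuous character of `T(𝔸_F)` takes the value `1`. [folklore] -/
theorem one_apply_torus (c : E ≃ₐ[F] E) (t : ↥(TorusDict.torus c)) : (1 : ↥(TorusDict.torus c) →ₜ* ℂˣ) t = 1 := by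
  rw [ContinuousMonoidHom.coe_one, Pi.one_apply]

/-- The trivial continuous character of `T(𝔸_F)` is automorphic. [folklore] -/
theorem isAutomorphic_one (c : E ≃ₐ[F] E) : TorusDict.IsAutomorphic c (1 : ↥(TorusDict.torus c) →ₜ* ℂˣ) := fun t _ => one_apply_torus c t

end One

/-- **THE SCATTERING COORDINATES IN A BASIS OF `V(χʷ, K′, ω)` ARE HOLOMORPHIC ON `{2 < Re}` — `χ₂ = 1` READ-BACK** (`U(2,1)_{L∕L⁺}`; `K′ ≤ K_max`, `φ ∈ V(χ, K′, ω)` continuous bounded,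
`bV` a basis of `V(reflectChar c χ, K′, ω)`): ★ row 7c `exists_scatteringCoords_cm_three` with its span letter discharged by ★ `intertwinedCoeff_mem_chiSectionSpacePair` read at `χ₂ = 1`
through ★ `chiSectionSpacePair_one`.  The literal `N = 3` twin of ★ `exists_scatteringCoords_of_basis_cm_two`. [cite: BernsteinLapid2019, §4 p. 10, §7] [cite: MoeglinWaldspurger1995, II.1.7] -/
theorem exists_scatteringCoords_of_basis_cm_three_one (ν : Measure ↥(adelicUnipotent (↥(maximalRealSubfield L)) L (IsCMField.complexConj L) 3)) [ν.IsHaarMeasure]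
    {𝓕 : Set ↥(adelicUnipotent (↥(maximalRealSubfield L)) L (IsCMField.complexConj L) 3)} (h𝓕N : IsFundamentalDomain ↥(rationalUnipotent (↥(maximalRealSubfield L)) L (IsCMField.complexConj L) 3) 𝓕 ν) (h𝓕c : IsCompact (closure 𝓕))
    {χ : HeckeCharacter L} {K' : Subgroup (quasiSplit (↥(maximalRealSubfield L)) L (IsCMField.complexConj L) 3).Adelic} {ω : ↥K' → ℂ}
    (hK' : K' ≤ ((standardMaximalCompactGL 3 L).comap (adelicVal (↥(maximalRealSubfield L)) L (IsCMField.complexConj L) 3 ((StdForm.antidiagonal 3).over L)) : Subgroup (quasiSplit (↥(maximalRealSubfield L)) L (IsCMField.complexConj L) 3).Adelic))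
    {φ : (quasiSplit (↥(maximalRealSubfield L)) L (IsCMField.complexConj L) 3).Adelic → ℂ} (hφV : φ ∈ chiSectionSpace χ K' ω) (hφc : Continuous φ) {Mφ : ℝ} (hφM : ∀ x, ‖φ x‖ ≤ Mφ)
    {ι' : Type} [Fintype ι'] [DecidableEq ι'] (bV : Module.Basis ι' ℂ ↥(chiSectionSpace (reflectChar (IsCMField.complexConj L) χ) K' ω)) :
    ∃ q : ι' → ℂ → ℂ, (∀ j, DifferentiableOn ℂ (q j) {z : ℂ | 2 < z.re}) ∧
      ∀ z : ℂ, 2 < z.re → (∑ j, q j z • ((bV j : ↥(chiSectionSpace (reflectChar (IsCMField.complexConj L) χ) K' ω)) : (quasiSplit (↥(maximalRealSubfield L)) L (IsCMField.complexConj L) 3).Adelic → ℂ)) =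
        ((((ν 𝓕).toReal⁻¹ : ℝ)) : ℂ) • (fun g : (quasiSplit (↥(maximalRealSubfield L)) L (IsCMField.complexConj L) 3).Adelic =>
          (∫ v : ↥(adelicUnipotent (↥(maximalRealSubfield L)) L (IsCMField.complexConj L) 3), flatSectionU φ z ((quasiSplit (↥(maximalRealSubfield L)) L (IsCMField.complexConj L) 3).toAdelic
            (weylLongU ((IsCMField.complexConj L : L ≃ₐ[↥(maximalRealSubfield L)] L) : L →+* L) (rfl : (StdForm.antidiagonal 3).over L = (StdForm.antidiagonal 3).over L)) *
              ((v : (quasiSplit (↥(maximalRealSubfield L)) L (IsCMField.complexConj L) 3).Adelic) * g)) ∂ν) * (((borelHeight g : ℝ) : ℂ) ^ (z - 2))) := by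
  have hc : IsCMField.complexConj L * IsCMField.complexConj L = 1 := AlgEquiv.ext fun x => by rw [AlgEquiv.mul_apply, AlgEquiv.one_apply, IsCMField.complexConj_apply_apply]
  have hc1 : IsCMField.complexConj L ≠ 1 := IsCMField.complexConj_ne_one L
  have hli : LinearIndependent ℂ (fun j => ((bV j : ↥(chiSectionSpace (reflectChar (IsCMField.complexConj L) χ) K' ω)) : (quasiSplit (↥(maximalRealSubfield L)) L (IsCMField.complexConj L) 3).Adelic → ℂ)) :=
    bV.linearIndependent.map' (Submodule.subtype _) (Submodule.ker_subtype _)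
  have hφV1 : φ ∈ chiSectionSpacePair χ (1 : ↥(TorusDict.torus (IsCMField.complexConj L)) →ₜ* ℂˣ) K' ω := by rw [chiSectionSpacePair_one]; exact hφV
  refine exists_scatteringCoords_cm_three L ν h𝓕N h𝓕c hφc hφM hli fun z _ => ?_
  have hmem := intertwinedCoeff_mem_chiSectionSpacePair hc hc1 ν hK' hφV1 hφc.measurable z
  rw [chiSectionSpacePair_one] at hmem
  obtain ⟨w, hw⟩ : ∃ w : ↥(chiSectionSpace (reflectChar (IsCMField.complexConj L) χ) K' ω), (w : (quasiSplit (↥(maximalRealSubfield L)) L (IsCMField.complexConj L) 3).Adelic → ℂ) =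
      (fun g : (quasiSplit (↥(maximalRealSubfield L)) L (IsCMField.complexConj L) 3).Adelic =>
        (∫ v : ↥(adelicUnipotent (↥(maximalRealSubfield L)) L (IsCMField.complexConj L) 3), flatSectionU φ z ((quasiSplit (↥(maximalRealSubfield L)) L (IsCMField.complexConj L) 3).toAdelic
          (weylLongU ((IsCMField.complexConj L : L ≃ₐ[↥(maximalRealSubfield L)] L) : L →+* L) (rfl : (StdForm.antidiagonal 3).over L = (StdForm.antidiagonal 3).over L)) *
            ((v : (quasiSplit (↥(maximalRealSubfield L)) L (IsCMField.complexConj L) 3).Adelic) * g)) ∂ν) * (((borelHeight g : ℝ) : ℂ) ^ (z - 2))) := ⟨⟨_, hmem⟩, rfl⟩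
  rw [← hw, ← bV.sum_repr w, Submodule.coe_sum]
  refine Submodule.sum_mem _ fun j _ => ?_
  rw [Submodule.coe_smul]
  exact Submodule.smul_mem _ _ (Submodule.subset_span ⟨j, rfl⟩)

/-! ## §2 The M1 print at `N = 3` -/

/-- **THE M1 PRINT — MEROMORPHIC CONTINUATION OF `E(f_z^φ)` AND OF ITS SCATTERING COORDINATES FOR `φ ∈ V(χ, K, 1)`, `φ ∘ ι_∞ = φ(1)`** (module docstring): holomorphic scattering
coordinates `q_j` on `{2 < Re}`, and (E1)–(E4): `Ec · g`, `qc_j` meromorphic in normal form on `ℂ`, `= E(f_z^φ)`, `= q_j` on `{2 < Re}`, one closed discrete pole set `P ⊆ {Re ≤ 2}`,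
analyticity off `P`, continuity in `g` off `P`. [cite: BernsteinLapid2019, Thm 2.3, §4, §7] [cite: MoeglinWaldspurger1995, II.1.7, IV.1.8–IV.1.11] -/
theorem chiEisenstein_meromorphic_exports_maximalLevel_cm_three
    (μ : Measure (quasiSplit (↥(maximalRealSubfield L)) L (IsCMField.complexConj L) 3).automorphicQuotient) [(quasiSplit (↥(maximalRealSubfield L)) L (IsCMField.complexConj L) 3).IsAutomorphicMeasure μ]
    (νG : Measure (quasiSplit (↥(maximalRealSubfield L)) L (IsCMField.complexConj L) 3).Adelic) [νG.IsHaarMeasure] [νG.IsInvInvariant] [SFinite νG]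
    (ν : Measure ↥(adelicUnipotent (↥(maximalRealSubfield L)) L (IsCMField.complexConj L) 3)) [ν.IsHaarMeasure] [ν.IsMulRightInvariant] [ν.IsInvInvariant]
    {𝓕 : Set ↥(adelicUnipotent (↥(maximalRealSubfield L)) L (IsCMField.complexConj L) 3)}
    (h𝓕N : IsFundamentalDomain ↥(rationalUnipotent (↥(maximalRealSubfield L)) L (IsCMField.complexConj L) 3) 𝓕 ν) (h𝓕c : IsCompact (closure 𝓕)) (h𝓕₀ : ν 𝓕 ≠ 0)
    {β : (quasiSplit (↥(maximalRealSubfield L)) L (IsCMField.complexConj L) 3).Adelic → ℝ≥0∞}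
    (hβ : IsCoveringWeight ↥((arithmeticBorel (↥(maximalRealSubfield L)) L (IsCMField.complexConj L) 3).map (quasiSplit (↥(maximalRealSubfield L)) L (IsCMField.complexConj L) 3).arithmeticSubgroup.subtype) β)
    {μZ : Measure (borelQuotient (↥(maximalRealSubfield L)) L (IsCMField.complexConj L) 3)} [SFinite μZ]
    (hμZ : ∀ f : borelQuotient (↥(maximalRealSubfield L)) L (IsCMField.complexConj L) 3 → ℝ≥0∞, Measurable f → ∫⁻ z, f z ∂μZ = ∫⁻ g, β g * f (toBorelQuotient (↥(maximalRealSubfield L)) L (IsCMField.complexConj L) 3 g) ∂νG)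
    -- the M1 family: `φ ∈ V(χ, K, 1)` continuous bounded with `φ ∘ ι_∞ = φ(1)`, and a basis of `V(χʷ, K, 1)` by continuous bounded functions
    {χ : HeckeCharacter L} {φ : (quasiSplit (↥(maximalRealSubfield L)) L (IsCMField.complexConj L) 3).Adelic → ℂ} (hφV : φ ∈ chiSectionSpace χ ((standardMaximalCompactGL 3 L).comap (adelicVal (↥(maximalRealSubfield L)) L (IsCMField.complexConj L) 3 ((StdForm.antidiagonal 3).over L)) : Subgroup (quasiSplit (↥(maximalRealSubfield L)) L (IsCMField.complexConj L) 3).Adelic) (fun _ => 1)) (hφc : Continuous φ) {Mφ : ℝ} (hφM : ∀ x, ‖φ x‖ ≤ Mφ)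
    (hφinf : ∀ a : arch (↥(maximalRealSubfield L)) L (IsCMField.complexConj L) 3 ((StdForm.antidiagonal 3).over L), φ (archToAdelic (↥(maximalRealSubfield L)) L (IsCMField.complexConj L) 3 _ a) = φ 1)
    {ι' : Type} [Fintype ι'] [DecidableEq ι'] (bV : Module.Basis ι' ℂ ↥(chiSectionSpace (reflectChar (IsCMField.complexConj L) χ) ((standardMaximalCompactGL 3 L).comap (adelicVal (↥(maximalRealSubfield L)) L (IsCMField.complexConj L) 3 ((StdForm.antidiagonal 3).over L)) : Subgroup (quasiSplit (↥(maximalRealSubfield L)) L (IsCMField.complexConj L) 3).Adelic) (fun _ => 1)))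
    (hbc : ∀ j, Continuous ((bV j : ↥(chiSectionSpace (reflectChar (IsCMField.complexConj L) χ) ((standardMaximalCompactGL 3 L).comap (adelicVal (↥(maximalRealSubfield L)) L (IsCMField.complexConj L) 3 ((StdForm.antidiagonal 3).over L)) : Subgroup (quasiSplit (↥(maximalRealSubfield L)) L (IsCMField.complexConj L) 3).Adelic) (fun _ => 1))) : (quasiSplit (↥(maximalRealSubfield L)) L (IsCMField.complexConj L) 3).Adelic → ℂ)) {Mb : ℝ} (hbM : ∀ j x, ‖((bV j : ↥(chiSectionSpace (reflectChar (IsCMField.complexConj L) χ) ((standardMaximalCompactGL 3 L).comap (adelicVal (↥(maximalRealSubfield L)) L (IsCMField.complexConj L) 3 ((StdForm.antidiagonal 3).over L)) : Subgroup (quasiSplit (↥(maximalRealSubfield L)) L (IsCMField.complexConj L) 3).Adelic) (fun _ => 1))) : (quasiSplit (↥(maximalRealSubfield L)) L (IsCMField.complexConj L) 3).Adelic → ℂ) x‖ ≤ Mb) :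
    ∃ (q : ι' → ℂ → ℂ) (Ec : ℂ → (quasiSplit (↥(maximalRealSubfield L)) L (IsCMField.complexConj L) 3).Adelic → ℂ) (qc : ι' → ℂ → ℂ) (P : Set ℂ),
      (∀ j, DifferentiableOn ℂ (q j) {z : ℂ | 2 < z.re}) ∧
      (∀ z : ℂ, 2 < z.re → (∑ j, q j z • ((bV j : ↥(chiSectionSpace (reflectChar (IsCMField.complexConj L) χ) ((standardMaximalCompactGL 3 L).comap (adelicVal (↥(maximalRealSubfield L)) L (IsCMField.complexConj L) 3 ((StdForm.antidiagonal 3).over L)) : Subgroup (quasiSplit (↥(maximalRealSubfield L)) L (IsCMField.complexConj L) 3).Adelic) (fun _ => 1))) : (quasiSplit (↥(maximalRealSubfield L)) L (IsCMField.complexConj L) 3).Adelic → ℂ)) = ((((ν 𝓕).toReal⁻¹ : ℝ)) : ℂ) • (fun g : (quasiSplit (↥(maximalRealSubfield L)) L (IsCMField.complexConj L) 3).Adelic => (∫ v : ↥(adelicUnipotent (↥(maximalRealSubfield L)) L (IsCMField.complexConj L) 3), flatSectionU φ z ((quasiSplit (↥(maximalRealSubfield L)) L (IsCMField.complexConj L)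 3).toAdelic (weylLongU ((IsCMField.complexConj L : L ≃ₐ[↥(maximalRealSubfield L)] L) : L →+* L) (rfl : (StdForm.antidiagonal 3).over L = (StdForm.antidiagonal 3).over L)) * ((v : (quasiSplit (↥(maximalRealSubfield L)) L (IsCMField.complexConj L) 3).Adelic) * g)) ∂ν) * (((borelHeight g : ℝ) : ℂ) ^ (z - 2)))) ∧
      (∀ g, MeromorphicNFOn (fun z => Ec z g) univ) ∧ (∀ j, MeromorphicNFOn (qc j) univ) ∧
      (∀ z : ℂ, 2 < z.re → Ec z = eisensteinSeriesU (flatSectionU φ z)) ∧ (∀ j (z : ℂ), 2 < z.re → qc j z = q j z) ∧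
      IsClosed P ∧ (∀ z₀ : ℂ, ∀ᶠ s in 𝓝[≠] z₀, s ∉ P) ∧ (∀ z ∈ P, z.re ≤ 2) ∧
      (∀ g (z : ℂ), z ∉ P → AnalyticAt ℂ (fun z => Ec z g) z) ∧ (∀ j (z : ℂ), z ∉ P → AnalyticAt ℂ (qc j) z) ∧
      (∀ g, DifferentiableOn ℂ (fun z => Ec z g) Pᶜ) ∧ (∀ j, DifferentiableOn ℂ (qc j) Pᶜ) ∧
      ∀ z : ℂ, z ∉ P → Continuous (Ec z) := by
  classical
  -- the scattering coordinates (§1, the `χ₂ = 1` read-back of ★ `exists_scatteringCoords_of_basis_cm_three`)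
  obtain ⟨q, hq, hqφ⟩ := exists_scatteringCoords_of_basis_cm_three_one L ν h𝓕N h𝓕c (le_refl _) hφV hφc hφM bV
  have hli : LinearIndependent ℂ (fun j => ((bV j : ↥(chiSectionSpace (reflectChar (IsCMField.complexConj L) χ) ((standardMaximalCompactGL 3 L).comap (adelicVal (↥(maximalRealSubfield L)) L (IsCMField.complexConj L) 3 ((StdForm.antidiagonal 3).over L)) : Subgroup (quasiSplit (↥(maximalRealSubfield L)) L (IsCMField.complexConj L) 3).Adelic) (fun _ => 1))) : (quasiSplit (↥(maximalRealSubfield L)) L (IsCMField.complexConj L) 3).Adelic → ℂ)) := bV.linearIndependent.map' (Submodule.subtype _) (Submodule.ker_subtype _)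
  have hφ'χ : ∀ j, IsChiSection (reflectChar (IsCMField.complexConj L) χ) ((bV j : ↥(chiSectionSpace (reflectChar (IsCMField.complexConj L) χ) ((standardMaximalCompactGL 3 L).comap (adelicVal (↥(maximalRealSubfield L)) L (IsCMField.complexConj L) 3 ((StdForm.antidiagonal 3).over L)) : Subgroup (quasiSplit (↥(maximalRealSubfield L)) L (IsCMField.complexConj L) 3).Adelic) (fun _ => 1))) : (quasiSplit (↥(maximalRealSubfield L)) L (IsCMField.complexConj L) 3).Adelic → ℂ) := fun j => (bV j).2.1
  -- ONE call of ★ row 6 X2_χ (A) at CM (`N = 3`, pair currency at `χ₂ = 1`: ★ `IsChiSection.isChiSectionPair_of_trivial`) with the M1 ball data (★ row 7a) as `hCD`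
  obtain ⟨Ec, qc, P, hE⟩ := chiEisenstein_meromorphic_exports_cm_three_of_letters L μ νG ν h𝓕N h𝓕c h𝓕₀ hβ hμZ (isAutomorphic_one (IsCMField.complexConj L))
    (IsChiSection.isChiSectionPair_of_trivial (one_apply_torus (IsCMField.complexConj L)) (isChiSection_of_mem hφV)) hφc hφM (isAutomorphic_one (IsCMField.complexConj L)) hli hbc
    (fun j => IsChiSection.isChiSectionPair_of_trivial (one_apply_torus (IsCMField.complexConj L)) (hφ'χ j)) hbM q hq hqφ fun n => by
    obtain ⟨a, ha, I, hIf, i₀, η, κ, T, hη, hconv, h1, hcov, -, hκ, hcmp, hι, -, hT, hpack, -, hS1M⟩ := exists_convData_maximalLevel_cm_three L μ νG hβ hμZ n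
    exact ⟨I, hIf, i₀, η, a, ha, κ, T, fun i => (hη i).1, fun i => ⟨(hconv i).1, (hconv i).2.1, (hconv i).2.2.2.1, (hconv i).2.2.2.2.1, (hconv i).2.2.2.2.2⟩, h1, hcov, hκ, hcmp, hι, hT,
      hpack, fun i z _ x => hS1M i χ φ hφV hφinf z x⟩
  exact ⟨q, Ec, qc, P, hq, hqφ, hE⟩

end Summit.HodgeConjecture.HodgeConjecture.Cruxes.H413.K2E1ChiEisensteinMeromorphicExportsM1CMThree

end
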